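import Literature.Probability.LatticeModels.FKIsingAnnulusCrossingProofs
import Literature.Probability.LatticeModels.RandomClusterIsoInvariance
import Literature.Probability.LatticeModels.RandomClusterEmbedding
import HarnessLib

/-!
# DCS Lemma 6.3: reduction to the wired top rectangle, away from its short sides

Topic `Literature/Probability/LatticeModels` (trunk `StatMech`, family `crit-ising`). Second
instalment of the proved part of Duminil-Copin–Smirnov 2012, Lemma 6.3
(`fkIsing_annulusCrossing_le`: under the critical FK-Ising measure of the square annulus
`S_{n,2n} = [-2n, 2n]² ∖ (-n, n)²` wired on its boundary, an open crossing from the inner to the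
outer boundary has probability `≤ c < 1`), continuing `FKIsingAnnulusCrossingProofs.lean`.

Compared with the first instalment (`fkIsing_annulusCrossing_le_of_wiredRect_shortCrossing_le`),
the reduction proved here is sharpened in the two ways the planar duality of the tree
(`RandomClusterBoxDuality.lean`, squares only) requires downstream:

* the rectangle crossing extracted from an annulus crossing stays *off the outer ring* and stops
  at a prescribed row: an open path from `{‖x‖_∞ = n}` to `{‖x‖_∞ = 2n}`, cut at its first visit
  to the outer ring (`exists_walk_before_level`) and at its last visit to the inner long side
  (`exists_walk_to_level_subset`), contains, for one of the four sides `ℓ = ε x_i`, an open path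
  from `{ℓ = n}` to `{ℓ = 2n - 1 - j}` inside `{n ≤ ℓ ≤ 2n - 1 - j, ‖x‖_∞ ≤ 2n - 1}`
  (`exists_annulusSideCrossing_of_openCrossing`, any `j ≤ n - 1`);
* the four sides are reduced to the top one by the dihedral symmetry of the annulus and the
  invariance of the measure (`RandomClusterIsoInvariance.lean`): the annulus crossing probability
  is at most `1 - (1 - φ(top crossing))⁴` (`real_annulusCrossing_le_one_sub_pow_top`, FKG as in
  the first instalment);
* the annulus measure of the top crossing is at most its probability under the *wired top
  rectangle on its own vertex type* `R_T = [-2n, 2n] × [n, 2n]` with its ring `∂R_T` wired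
  (`real_annulusTopCrossing_le_wiredTopRect`): comparison of boundary conditions (wire everything
  at height `≤ n`), the domain Markov property (the edges below integrate out), and the transfer to
  the sub-rectangle's own vertex type (`RandomClusterEmbedding.lean`) — DCS Thm. 3.1 and §3.2.

The outcome `fkIsing_annulusCrossing_le_of_topRect`: **if for some `c₁ < 1`, some `n₀` and rows
`j(n) ≤ n - 1` the wired top rectangle gives probability `≤ c₁` to an open path from its bottom
side `{x₁ = n}` to the row `{x₁ = 2n - 1 - j(n)}` inside `[-2n+1, 2n-1] × [n, 2n-1-j(n)]`, for all
`n ≥ n₀`, then `fkIsing_annulusCrossing_le` holds** (small `n` are absorbed into the constant: each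
crossing probability is `< 1` because the empty configuration has positive mass). The remaining
input — that bound, from Thm. 3.16 by duality — is the subject of the sequel. Everything here is
proved; no new named facts (D-0026).

## References

* H. Duminil-Copin, S. Smirnov, *Conformal invariance of lattice models*, Clay Math. Proc. 15
  (2012) 213–276, arXiv:1109.1549: Thm. 3.1, §3.2, Lemma 6.3 and its proof (p. 27).
* G. Grimmett, *The Random-Cluster Model*, Springer (2006): Thm. 3.8 (FKG), Lemma 4.13,
  Lemma 4.14, §4.3.
* H. Kesten, *Percolation Theory for Mathematicians*, Birkhäuser (1982), §2.2 (first and last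
  intersections of paths with sets).
-/

noncomputable section

open MeasureTheory
open Literature.Probability.LatticeModels Literature.Probability.Percolation

namespace Literature.Probability.LatticeModels

/-! ### Walks and level sets: first visits, last visits, with control of the vertices -/

section WalkLevel

variable {V : Type*}

/-- **Stopping a walk just before it first reaches a level.** Let `ℓ : V → ℤ` increase by at most
`1` along the edges of `H`. A walk from `u` with `ℓ u < b` to `x` with `b ≤ ℓ x` has an initial
segment ending at a vertex of level exactly `b - 1` all of whose vertices have level `< b` (stop
at the vertex preceding the first vertex of level `≥ b`). (Kesten 1982, §2.2.) [folklore] -/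
theorem exists_walk_before_level {H : SimpleGraph V} (ℓ : V → ℤ)
    (hH : ∀ ⦃u v : V⦄, H.Adj u v → ℓ v ≤ ℓ u + 1) {b : ℤ} {u x : V} (w : H.Walk u x) :
    ℓ u < b → b ≤ ℓ x →
      ∃ (v : V) (w' : H.Walk u v), ℓ v = b - 1 ∧ (∀ z ∈ w'.support, ℓ z < b) ∧
        w'.support ⊆ w.support := by
  induction w with
  | nil => intro hu hx; omega
  | @cons u u₁ x hadj w₁ ih =>
    intro hu hx
    by_cases h₁ : ℓ u₁ < b
    · obtain ⟨v, w', hv, hlt, hsub⟩ := ih h₁ hx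
      refine ⟨v, .cons hadj w', hv, fun z hz ↦ ?_, fun z hz ↦ ?_⟩
      · rw [SimpleGraph.Walk.support_cons, List.mem_cons] at hz
        rcases hz with rfl | hz
        · exact hu
        · exact hlt z hz
      · rw [SimpleGraph.Walk.support_cons, List.mem_cons] at hz ⊢
        rcases hz with rfl | hz
        · exact Or.inl rfl
        · exact Or.inr (hsub hz)
    · have := hH hadj
      refine ⟨u, .nil, by omega, fun z hz ↦ ?_, fun z hz ↦ ?_⟩
      · rw [SimpleGraph.Walk.support_nil, List.mem_singleton] at hz
        rw [hz]; exact hu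
      · rw [SimpleGraph.Walk.support_nil, List.mem_singleton] at hz
        rw [SimpleGraph.Walk.support_cons, List.mem_cons]
        exact Or.inl hz

/-- **First visit of a walk to a lower level, with the vertices controlled** (the lemma
`exists_walk_to_level` of `FKIsingAnnulusCrossingProofs.lean`, plus the inclusion of supports):
if `ℓ` decreases by at most `1` along edges, a walk from `u` with `a ≤ ℓ u` to `x` with
`ℓ x ≤ a` has an initial segment to a vertex of level exactly `a` whose vertices all have level
`≥ a` and are vertices of the walk. (Kesten 1982, §2.2.) [folklore] -/
theorem exists_walk_to_level_subset {H : SimpleGraph V} (ℓ : V → ℤ)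
    (hH : ∀ ⦃u v : V⦄, H.Adj u v → ℓ u ≤ ℓ v + 1) {a : ℤ} {u x : V} (w : H.Walk u x) :
    a ≤ ℓ u → ℓ x ≤ a →
      ∃ (v : V) (w' : H.Walk u v), ℓ v = a ∧ (∀ z ∈ w'.support, a ≤ ℓ z) ∧
        w'.support ⊆ w.support := by
  induction w with
  | nil =>
    intro hu hx
    rename_i u
    exact ⟨u, .nil, le_antisymm hx hu, by simpa using hu, fun z hz ↦ hz⟩
  | @cons u u₁ x hadj w₁ ih =>
    intro hu hx
    by_cases heq : ℓ u = a
    · refine ⟨u, .nil, heq, by simpa using hu, fun z hz ↦ ?_⟩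
      rw [SimpleGraph.Walk.support_nil, List.mem_singleton] at hz
      rw [SimpleGraph.Walk.support_cons, List.mem_cons]
      exact Or.inl hz
    · have hu₁ : a ≤ ℓ u₁ := by have := hH hadj; omega
      obtain ⟨v, w', hv, hsupp, hsub⟩ := ih hu₁ hx
      refine ⟨v, .cons hadj w', hv, fun z hz ↦ ?_, fun z hz ↦ ?_⟩
      · rw [SimpleGraph.Walk.support_cons, List.mem_cons] at hz
        rcases hz with rfl | hz
        · exact hu
        · exact hsupp z hz
      · rw [SimpleGraph.Walk.support_cons, List.mem_cons] at hz ⊢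
        rcases hz with rfl | hz
        · exact Or.inl rfl
        · exact Or.inr (hsub hz)

end WalkLevel

/-! ### Transport of open crossings along an injection of vertex types -/

section EmbedCrossing

variable {V U : Type*} (j : V ↪ U)

/-- An injection of vertex types maps the open graph of `ω` into the open graph of `j(ω)`.
[folklore] -/
def openGraphMapHom (ω : BondConfig V) : openGraph ω →g openGraph (Sym2.map j '' ω) where
  toFun := j
  map_rel' := by
    intro x y h
    rw [openGraph_adj] at h ⊢
    exact ⟨⟨s(x, y), h.1, Sym2.map_mk _ _ _⟩, fun h' ↦ h.2 (j.injective h')⟩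

/-- **Open crossings are transported along an injection of vertex types**: `j(ω)` has an open
crossing of `j(S)` from `j(A)` to `j(B)` iff `ω` has an open crossing of `S` from `A` to `B`
(open paths inside `j(S)` only visit vertices of the range and pull back edge by edge).
[folklore] -/
theorem map_image_mem_openCrossing_iff (ω : BondConfig V) (S A B : Set V) :
    Sym2.map j '' ω ∈ openCrossing (j '' S) (j '' A) (j '' B) ↔ ω ∈ openCrossing S A B := by
  classical
  constructor
  · rintro ⟨_, ⟨a, ha, rfl⟩, _, ⟨b, hb, rfl⟩, hab⟩
    obtain ⟨haS, hbS, hr⟩ := hab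
    -- pull back a walk of the open graph of `j ω` inside `j S`
    have key : ∀ (p q : ↥(j '' S)) (W : ((openGraph (Sym2.map j '' ω)).induce (j '' S)).Walk p q)
        (x y : V), j x = p.1 → j y = q.1 → ω ∈ openConnIn S x y := by
      intro p q W
      induction W with
      | nil =>
        intro x y hx hy
        rename_i p
        have hxy : x = y := j.injective (hx.trans hy.symm)
        subst hxy
        obtain ⟨x', hx'S, hx'⟩ := p.2
        have : x' = x := j.injective (hx'.trans hx.symm)
        subst this
        exact openConnIn_refl hx'S
      | @cons p p₁ q hadj W₁ ih =>
        intro x y hx hy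
        obtain ⟨x₁, hx₁S, hx₁⟩ := p₁.2
        have hadj' : (openGraph (Sym2.map j '' ω)).Adj p.1 p₁.1 := hadj
        rw [← hx, ← hx₁, openGraph_adj] at hadj'
        have hxx₁ : s(x, x₁) ∈ ω := mem_of_map_mem_image j hadj'.1
        have hne : x ≠ x₁ := fun h ↦ hadj'.2 (congrArg j h)
        obtain ⟨x', hx'S, hx'⟩ := p.2
        have : x' = x := j.injective (hx'.trans hx.symm)
        subst this
        exact PlanarDuality.openConnIn_trans (openConnIn_of_adj hx'S hx₁S hxx₁ hne) (ih x₁ y hx₁ hy)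
    obtain ⟨W⟩ := hr
    exact ⟨a, ha, b, hb, key _ _ W a b rfl rfl⟩
  · rintro ⟨a, ha, b, hb, hab⟩
    obtain ⟨haS, hbS, hr⟩ := hab
    refine ⟨j a, ⟨a, ha, rfl⟩, j b, ⟨b, hb, rfl⟩, ⟨a, haS, rfl⟩, ⟨b, hbS, rfl⟩, ?_⟩
    let f : (openGraph ω).induce S →g (openGraph (Sym2.map j '' ω)).induce (j '' S) :=
      { toFun := fun v ↦ ⟨j v.1, v.1, v.2, rfl⟩
        map_rel' := by
          intro p q h
          rw [SimpleGraph.induce_adj] at h ⊢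
          exact (openGraphMapHom j ω).map_rel h }
    exact hr.map f

end EmbedCrossing

/-! ### Events inside a vertex set only depend on the edges inside it -/

section Inside

variable {V : Type*}

/-- An open crossing inside `S` only uses open edges with both endpoints in `S`: for every set of
edges `F` containing all edges of `ω` inside `S`, `ω ∈ C(S; A, B)` iff `ω ∩ F ∈ C(S; A, B)`.
[folklore] -/
theorem mem_openCrossing_iff_inter {ω : BondConfig V} {F : Set (Sym2 V)} {S A B : Set V}
    (hF : ∀ e ∈ ω, (∀ x ∈ e, x ∈ S) → e ∈ F) :
    ω ∈ openCrossing S A B ↔ ω ∩ F ∈ openCrossing S A B := by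
  refine ⟨fun h ↦ ?_, fun h ↦ isUpperSet_openCrossing S A B Set.inter_subset_left h⟩
  obtain ⟨a, ha, b, hb, haS, hbS, hr⟩ := h
  refine ⟨a, ha, b, hb, haS, hbS, ?_⟩
  -- the induced open graph on `S` of `ω` is contained in that of `ω ∩ F`
  refine hr.mono ?_
  intro p q hpq
  rw [SimpleGraph.comap_adj, Function.Embedding.coe_subtype, openGraph_adj] at hpq ⊢
  refine ⟨⟨hpq.1, hF _ hpq.1 fun x hx ↦ ?_⟩, hpq.2⟩
  rcases Sym2.mem_iff.1 hx with rfl | rfl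
  · exact p.2
  · exact q.2

end Inside

/-! ### The four side crossings of the annulus, away from the outer ring -/

section Annulus

open SimpleGraph

/-- The sup-norm `‖x‖_∞ = max |x₀| |x₁|` of a site of `ℤ²`. [folklore] -/
def supNormTwo (x : Site 2) : ℤ := max |x 0| |x 1|

/-- The sup-norm is `1`-Lipschitz along the edges of `ℤ²`. [folklore] -/
theorem supNormTwo_le_of_adj {u v : Site 2} (h : (zdGraph 2).Adj u v) :
    supNormTwo u ≤ supNormTwo v + 1 := by
  have h0 := abs_le.1 (abs_sub_le_one_of_zdGraph_two_adj h 0)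
  have h1 := abs_le.1 (abs_sub_le_one_of_zdGraph_two_adj h 1)
  unfold supNormTwo
  have := abs_le.1 (le_max_left |v 0| |v 1|)
  have := abs_le.1 (le_max_right |v 0| |v 1|)
  rw [max_le_iff, abs_le, abs_le]
  omega

/-- A coordinate is at most the sup-norm in absolute value. [folklore] -/
theorem abs_apply_le_supNormTwo (x : Site 2) (k : Fin 2) : |x k| ≤ supNormTwo x := by
  fin_cases k
  · exact le_max_left _ _
  · exact le_max_right _ _

/-- **The side crossing, away from the outer ring**, of one of the four rectangles of the annulus
`S_{n,2n}`: for the outward coordinate `ℓ = ε x_i` and a margin `j`, an open path of the annulus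
from the inner long side `{ℓ = n}` to the row `{ℓ = 2n - 1 - j}` all of whose vertices satisfy
`n ≤ ℓ ≤ 2n - 1 - j` and `‖x‖_∞ ≤ 2n - 1` (so the path stays off the outer ring, one unit inside
the rectangle `R_ℓ = {n ≤ ℓ ≤ 2n}` of Duminil-Copin–Smirnov 2012, proof of Lemma 6.3).
[cite: DuminilCopinSmirnov2012Clay, proof of Lemma 6.3] -/
def annulusSideCrossing (n j : ℕ) (i : Fin 2) (ε : ℤˣ) :
    Set (BondConfig ↥(squareAnnulusSites n : Set (Site 2))) :=
  openCrossing {x | (n : ℤ) ≤ (ε : ℤ) * x.1 i ∧ (ε : ℤ) * x.1 i ≤ 2 * n - 1 - j ∧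
      supNormTwo x.1 ≤ 2 * n - 1}
    {x | (ε : ℤ) * x.1 i = n} {x | (ε : ℤ) * x.1 i = 2 * n - 1 - j}

/-- **The top crossing, away from the outer ring**: the side crossing for `ℓ = x₁`, i.e. an open
path from the row `{x₁ = n}` to the row `{x₁ = 2n - 1 - j}` inside
`[-2n+1, 2n-1] × [n, 2n-1-j]`. [cite: DuminilCopinSmirnov2012Clay, proof of Lemma 6.3] -/
def annulusTopCrossing (n j : ℕ) : Set (BondConfig ↥(squareAnnulusSites n : Set (Site 2))) :=
  openCrossing {x | (n : ℤ) ≤ x.1 1 ∧ x.1 1 ≤ 2 * n - 1 - j ∧ supNormTwo x.1 ≤ 2 * n - 1}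
    {x | x.1 1 = n} {x | x.1 1 = 2 * n - 1 - j}

/-- Side crossings are increasing events. [folklore] -/
theorem isUpperSet_annulusSideCrossing (n j : ℕ) (i : Fin 2) (ε : ℤˣ) :
    IsUpperSet (annulusSideCrossing n j i ε) :=
  isUpperSet_openCrossing _ _ _

/-- The top crossing is an increasing event. [folklore] -/
theorem isUpperSet_annulusTopCrossing (n j : ℕ) : IsUpperSet (annulusTopCrossing n j) :=
  isUpperSet_openCrossing _ _ _

/-- **From an annulus crossing to a side crossing away from the outer ring** (Duminil-Copin–Smirnov
2012, proof of Lemma 6.3, "one can construct from them a circuit", contrapositive primal form, with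
the cuts needed downstream): for `1 ≤ n` and `j ≤ n - 1`, an open path of the annulus from
`{‖x‖_∞ = n}` to `{‖x‖_∞ = 2n}` contains, for some side `ℓ = ε x_i`, an open path from `{ℓ = n}`
to `{ℓ = 2n-1-j}` inside `{n ≤ ℓ ≤ 2n-1-j, ‖x‖_∞ ≤ 2n-1}`: cut the path just before its first
visit to the outer ring (`exists_walk_before_level`), then after its last visit to `{ℓ = n}`
(`exists_walk_to_level_subset` on the reversed path), then at its first visit to `{ℓ = 2n-1-j}`.
[cite: DuminilCopinSmirnov2012Clay, proof of Lemma 6.3] -/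
theorem exists_annulusSideCrossing_of_openCrossing {n j : ℕ} (hn : 1 ≤ n) (hj : j + 1 ≤ n)
    {ω : BondConfig ↥(squareAnnulusSites n : Set (Site 2))}
    (hω : ω ⊆ ((zdGraph 2).induce (squareAnnulusSites n : Set (Site 2))).edgeSet)
    (h : ω ∈ openCrossing Set.univ (squareAnnulusInner n) (squareAnnulusOuter n)) :
    ∃ (i : Fin 2) (ε : ℤˣ), ω ∈ annulusSideCrossing n j i ε := by
  obtain ⟨x, hx, y, hy, hxy⟩ := h
  obtain ⟨hxu, hyu, hr⟩ := hxy
  have hr' : (openGraph ω).Reachable x y :=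
    SimpleGraph.Reachable.map (SimpleGraph.induceUnivIso (openGraph ω)).toHom hr
  obtain ⟨W⟩ := hr'
  have hx' : supNormTwo x.1 = n := hx
  have hy' : supNormTwo y.1 = 2 * n := hy
  have hadj : ∀ ⦃u v : ↥(squareAnnulusSites n : Set (Site 2))⦄, (openGraph ω).Adj u v →
      (zdGraph 2).Adj u.1 v.1 := fun u v huv ↦ by
    rw [openGraph_adj] at huv
    exact (SimpleGraph.mem_edgeSet _).1 (hω huv.1)
  -- (1) stop just before the first visit to the outer ring
  obtain ⟨v, W₁, hv, hlt, -⟩ := exists_walk_before_level (H := openGraph ω)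
    (fun z ↦ supNormTwo z.1) (fun u v huv ↦ supNormTwo_le_of_adj (hadj huv).symm) W
    (b := 2 * n) (by rw [hx']; omega) (by rw [hy'])
  -- the outward coordinate of the endpoint
  obtain ⟨i, ε, hiv⟩ := exists_units_mul_eq_of_max_abs_eq (x := v.1) (m := 2 * n - 1) hv
  have hℓ : ∀ ⦃u w : ↥(squareAnnulusSites n : Set (Site 2))⦄, (openGraph ω).Adj u w →
      (ε : ℤ) * u.1 i ≤ (ε : ℤ) * w.1 i + 1 := fun u w huw ↦
    units_mul_le_of_zdGraph_two_adj (hadj huw) i ε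
  -- (2) after the last visit to the inner long side `{ℓ = n}` (first visit on the reversed walk)
  obtain ⟨v', W₂, hv', hge, hsub₂⟩ := exists_walk_to_level_subset (H := openGraph ω)
    (fun z ↦ (ε : ℤ) * z.1 i) hℓ W₁.reverse (a := n) (by rw [hiv]; omega)
    ((units_mul_le_max_abs x.1 i ε).trans (by rw [show max |x.1 0| |x.1 1| = supNormTwo x.1 from rfl, hx']))
  -- (3) up to the first visit to the row `{ℓ = 2n - 1 - j}`
  obtain ⟨v'', W₃, hv'', hle, hsub₃⟩ := exists_walk_to_level_subset (H := openGraph ω)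
    (fun z ↦ -((ε : ℤ) * z.1 i)) (fun u w huw ↦ by have := hℓ huw.symm; omega) W₂.reverse
    (a := -(2 * n - 1 - j)) (by rw [hv']; omega) (by rw [hiv]; omega)
  refine ⟨i, ε, v', hv', v'', by simp only [Set.mem_setOf_eq]; omega, ?_⟩
  refine mem_openConnIn_of_walk W₃ (fun z hz ↦ ?_) (fun e he ↦ ?_)
  · have h3 := hle z hz
    have hz₂ : z ∈ W₂.support := by
      have := hsub₃ hz; rwa [SimpleGraph.Walk.support_reverse, List.mem_reverse] at this
    have h2 := hge z hz₂
    have hz₁ : z ∈ W₁.support := by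
      have := hsub₂ hz₂; rwa [SimpleGraph.Walk.support_reverse, List.mem_reverse] at this
    have h1 := hlt z hz₁
    simp only [Set.mem_setOf_eq]
    omega
  · exact edgeSet_openGraph_subset ω (SimpleGraph.Walk.edges_subset_edgeSet _ he)

end Annulus

/-! ### The dihedral symmetry of the annulus: the four sides are equiprobable -/

section Symmetry

open SimpleGraph

/-- The symmetry of `ℤ²` carrying the side `ℓ = ε x_i` of the annulus to the top side: the signed
coordinate permutation `g` with `(g x)₁ = ε x_i` and `(g x)₀ = x_{1-i}` (the identity, a
reflection, the transposition of the axes, or their composite). [folklore] -/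
def sideToTopIso (i : Fin 2) (ε : ℤˣ) : zdGraph 2 ≃g zdGraph 2 :=
  zdSignedPermIso (if i = 1 then 1 else Equiv.swap 0 1) (fun k ↦ if k = 1 then ε else 1)

/-- Coordinates of the inverse symmetry (the inverse of a signed coordinate permutation, as in
`Site.signedPerm_symm_apply`). [folklore] -/
theorem sideToTopIso_symm_apply (i : Fin 2) (ε : ℤˣ) (y : Site 2) (k : Fin 2) :
    (sideToTopIso i ε).symm y k =
      ((fun k ↦ if k = 1 then ε else 1 : Fin 2 → ℤˣ)
          ((if i = 1 then 1 else Equiv.swap 0 1 : Equiv.Perm (Fin 2)) k) : ℤ) *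
        y ((if i = 1 then 1 else Equiv.swap 0 1 : Equiv.Perm (Fin 2)) k) := rfl

/-- The inverse symmetry recovers the outward coordinate from the height: `ε (g⁻¹ y)_i = y₁`.
[folklore] -/
theorem units_mul_sideToTopIso_symm_apply (i : Fin 2) (ε : ℤˣ) (y : Site 2) :
    (ε : ℤ) * (sideToTopIso i ε).symm y i = y 1 := by
  rw [sideToTopIso_symm_apply]
  have hε : (ε : ℤ) * ε = 1 := by
    rcases Int.units_eq_one_or ε with rfl | rfl <;> simp
  have hi : i = 0 ∨ i = 1 := by fin_cases i <;> simp
  rcases hi with rfl | rfl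
  · simp [← mul_assoc, hε]
  · simp [← mul_assoc, hε]

/-- The inverse symmetry preserves the sup-norm. [folklore] -/
theorem supNormTwo_sideToTopIso_symm (i : Fin 2) (ε : ℤˣ) (y : Site 2) :
    supNormTwo ((sideToTopIso i ε).symm y) = supNormTwo y := by
  unfold supNormTwo
  rw [sideToTopIso_symm_apply, sideToTopIso_symm_apply]
  have hi : i = 0 ∨ i = 1 := by fin_cases i <;> simp
  rcases hi with rfl | rfl <;> rcases Int.units_eq_one_or ε with rfl | rfl <;>
    simp [Equiv.swap_apply_left, Equiv.swap_apply_right, abs_neg, max_comm]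

/-- The symmetries preserve the annulus. [folklore] -/
theorem mem_squareAnnulusSites_iff_sideToTopIso_symm (n : ℕ) (i : Fin 2) (ε : ℤˣ) (y : Site 2) :
    y ∈ squareAnnulusSites n ↔ (sideToTopIso i ε).symm y ∈ squareAnnulusSites n := by
  rw [mem_squareAnnulusSites_iff, mem_squareAnnulusSites_iff]
  change _ ↔ (n : ℤ) ≤ supNormTwo ((sideToTopIso i ε).symm y) ∧
    supNormTwo ((sideToTopIso i ε).symm y) ≤ 2 * n
  rw [supNormTwo_sideToTopIso_symm]
  rfl

/-- The induced automorphism of the nearest-neighbour graph of the annulus, on the vertex type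
`↥(squareAnnulusSites n : Set (Site 2))` of `fkIsingFiniteMeasure`. [folklore] -/
def annulusSideToTopIso (n : ℕ) (i : Fin 2) (ε : ℤˣ) :
    (zdGraph 2).induce (squareAnnulusSites n : Set (Site 2)) ≃g
      (zdGraph 2).induce (squareAnnulusSites n : Set (Site 2)) where
  toEquiv :=
    { toFun := fun x ↦ ⟨sideToTopIso i ε x.1,
        (mem_squareAnnulusSites_iff_sideToTopIso_symm n i ε _).2
          (by rw [RelIso.symm_apply_apply]; exact x.2)⟩
      invFun := fun y ↦ ⟨(sideToTopIso i ε).symm y.1,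
        (mem_squareAnnulusSites_iff_sideToTopIso_symm n i ε y.1).1 y.2⟩
      left_inv := fun x ↦ Subtype.ext (RelIso.symm_apply_apply (sideToTopIso i ε) x.1)
      right_inv := fun y ↦ Subtype.ext (RelIso.apply_symm_apply (sideToTopIso i ε) y.1) }
  map_rel_iff' := by
    intro a b
    exact (sideToTopIso i ε).map_rel_iff

/-- The induced automorphism acts by `g` on the underlying sites. [folklore] -/
@[simp] theorem annulusSideToTopIso_apply_coe (n : ℕ) (i : Fin 2) (ε : ℤˣ)
    (x : ↥(squareAnnulusSites n : Set (Site 2))) :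
    ((annulusSideToTopIso n i ε) x).1 = sideToTopIso i ε x.1 := rfl

/-- Its inverse acts by `g⁻¹` on the underlying sites. [folklore] -/
@[simp] theorem annulusSideToTopIso_symm_apply_coe (n : ℕ) (i : Fin 2) (ε : ℤˣ)
    (y : ↥(squareAnnulusSites n : Set (Site 2))) :
    ((annulusSideToTopIso n i ε).symm y).1 = (sideToTopIso i ε).symm y.1 := rfl

/-- The same for the inverse of the underlying equivalence. [folklore] -/
@[simp] theorem annulusSideToTopIso_toEquiv_symm_apply_coe (n : ℕ) (i : Fin 2) (ε : ℤˣ)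
    (y : ↥(squareAnnulusSites n : Set (Site 2))) :
    ((annulusSideToTopIso n i ε).toEquiv.symm y).1 = (sideToTopIso i ε).symm y.1 := rfl

/-- The pull-back of the top crossing by the symmetry of the side `ℓ = ε x_i`: the event that the
transformed configuration `g(ω)` has the top crossing. [folklore] -/
def annulusSideEvent (n j : ℕ) (i : Fin 2) (ε : ℤˣ) :
    Set (BondConfig ↥(squareAnnulusSites n : Set (Site 2))) :=
  BondConfig.relabel (sym2Equiv (annulusSideToTopIso n i ε).toEquiv) ⁻¹' annulusTopCrossing n j

/-- The pulled-back events are increasing. [folklore] -/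
theorem isUpperSet_annulusSideEvent (n j : ℕ) (i : Fin 2) (ε : ℤˣ) :
    IsUpperSet (annulusSideEvent n j i ε) :=
  (isUpperSet_annulusTopCrossing n j).preimage_relabel _

/-- **The symmetry carries the side crossing to the top crossing**: the side crossing of
`ℓ = ε x_i` is contained in the pull-back of the top crossing by `g`. [folklore] -/
theorem annulusSideCrossing_subset_annulusSideEvent (n j : ℕ) (i : Fin 2) (ε : ℤˣ) :
    annulusSideCrossing n j i ε ⊆ annulusSideEvent n j i ε := by
  intro ω hω
  have h := relabel_mem_openCrossing (annulusSideToTopIso n i ε).toEquiv hω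
  change BondConfig.relabel _ ω ∈ openCrossing _ _ _
  simp only [Equiv.image_eq_preimage_symm, Set.preimage_setOf_eq,
    annulusSideToTopIso_toEquiv_symm_apply_coe, units_mul_sideToTopIso_symm_apply,
    supNormTwo_sideToTopIso_symm] at h
  exact h

/-- The symmetries fix the wired set "inner ∪ outer boundary" of the annulus. [folklore] -/
theorem image_annulusSideToTopIso_inner_union_outer (n : ℕ) (i : Fin 2) (ε : ℤˣ) :
    (annulusSideToTopIso n i ε) '' (squareAnnulusInner n ∪ squareAnnulusOuter n) =
      squareAnnulusInner n ∪ squareAnnulusOuter n := by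
  rw [show ((annulusSideToTopIso n i ε) '' (squareAnnulusInner n ∪ squareAnnulusOuter n)) =
      (annulusSideToTopIso n i ε).toEquiv '' (squareAnnulusInner n ∪ squareAnnulusOuter n) from rfl,
    Equiv.image_eq_preimage_symm]
  ext y
  simp only [Set.preimage_union, Set.mem_union, Set.mem_preimage]
  change supNormTwo ((annulusSideToTopIso n i ε).toEquiv.symm y).1 = n ∨
      supNormTwo ((annulusSideToTopIso n i ε).toEquiv.symm y).1 = 2 * n ↔
    supNormTwo y.1 = n ∨ supNormTwo y.1 = 2 * n
  rw [annulusSideToTopIso_toEquiv_symm_apply_coe, supNormTwo_sideToTopIso_symm]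

/-- **The four sides are equiprobable** (invariance of the random-cluster measure under the
automorphisms of the annulus fixing its wired boundary, `rcMeasure_real_preimage_relabel`): the
pull-back of the top crossing by the symmetry of any side has the probability of the top crossing,
under the critical FK-Ising measure of the annulus wired on its inner and outer boundary.
[cite: Grimmett2006, §4.3] -/
theorem real_annulusSideEvent (n j : ℕ) (i : Fin 2) (ε : ℤˣ) :
    (fkIsingFiniteMeasure (squareAnnulusSites n) (squareAnnulusInner n ∪ squareAnnulusOuter n)).real
        (annulusSideEvent n j i ε) =
      (fkIsingFiniteMeasure (squareAnnulusSites n) (squareAnnulusInner n ∪ squareAnnulusOuter n)).real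
        (annulusTopCrossing n j) := by
  unfold annulusSideEvent fkIsingFiniteMeasure
  rw [rcMeasure_real_preimage_relabel (annulusSideToTopIso n i ε) criticalFKIsingParam_mem_Icc two_pos,
    image_annulusSideToTopIso_inner_union_outer]

/-- **The annulus crossing probability and the top crossing** (Duminil-Copin–Smirnov 2012, proof of
Lemma 6.3, steps "one can construct from them a circuit" and "the FKG inequality implies that the
probability of a circuit is larger than `c₁⁴`", with the four sides identified by symmetry): for
`1 ≤ n` and `j ≤ n - 1`, under the critical FK-Ising measure of the annulus `S_{n,2n}` wired on
its inner and outer boundary, the probability of an open crossing from the inner to the outer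
boundary is at most `1 - (1 - φ(top crossing with margin j))⁴`.
[cite: DuminilCopinSmirnov2012Clay, proof of Lemma 6.3] -/
theorem real_annulusCrossing_le_one_sub_pow_top {n j : ℕ} (hn : 1 ≤ n) (hj : j + 1 ≤ n) :
    (fkIsingFiniteMeasure (squareAnnulusSites n) (squareAnnulusInner n ∪ squareAnnulusOuter n)).real
        (openCrossing Set.univ (squareAnnulusInner n) (squareAnnulusOuter n)) ≤
      1 - (1 - (fkIsingFiniteMeasure (squareAnnulusSites n)
        (squareAnnulusInner n ∪ squareAnnulusOuter n)).real (annulusTopCrossing n j)) ^ 4 := by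
  classical
  set μ := fkIsingFiniteMeasure (squareAnnulusSites n)
    (squareAnnulusInner n ∪ squareAnnulusOuter n) with hμ
  have hp := criticalFKIsingParam_mem_Icc
  have hq : (1 : ℝ) ≤ 2 := one_le_two
  -- crossing ⊆ ⋃ side events, on lattice configurations
  have h1 : μ.real (openCrossing Set.univ (squareAnnulusInner n) (squareAnnulusOuter n)) ≤
      μ.real (⋃ k : Fin 2 × ℤˣ, annulusSideEvent n j k.1 k.2) := by
    rw [hμ]; unfold fkIsingFiniteMeasure
    refine rcMeasure_real_mono_of_forall_subset_edgeSet _ hp two_pos _ fun ω hωE hω ↦ ?_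
    obtain ⟨i, ε, h⟩ := exists_annulusSideCrossing_of_openCrossing hn hj hωE hω
    exact Set.mem_iUnion.2 ⟨(i, ε), annulusSideCrossing_subset_annulusSideEvent n j i ε h⟩
  -- FKG for the four decreasing complements
  have h2 : ∏ k : Fin 2 × ℤˣ, (1 - μ.real (annulusSideEvent n j k.1 k.2)) ≤
      μ.real (⋂ k ∈ (Finset.univ : Finset (Fin 2 × ℤˣ)), (annulusSideEvent n j k.1 k.2)ᶜ) := by
    have h := rcMeasure_prod_real_le_biInter_of_isLowerSet
      ((zdGraph 2).induce (squareAnnulusSites n : Set (Site 2))) hp hq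
      (squareAnnulusInner n ∪ squareAnnulusOuter n) Finset.univ
      (fun k : Fin 2 × ℤˣ ↦ (annulusSideEvent n j k.1 k.2)ᶜ)
      (fun k _ ↦ (isUpperSet_annulusSideEvent n j k.1 k.2).compl)
    calc ∏ k : Fin 2 × ℤˣ, (1 - μ.real (annulusSideEvent n j k.1 k.2))
        = ∏ k : Fin 2 × ℤˣ, μ.real (annulusSideEvent n j k.1 k.2)ᶜ :=
          Finset.prod_congr rfl fun k _ ↦
            (probReal_compl_eq_one_sub MeasurableSet.of_discrete).symm
      _ ≤ _ := h
  have h3 : μ.real (⋃ k : Fin 2 × ℤˣ, annulusSideEvent n j k.1 k.2) =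
      1 - μ.real (⋂ k ∈ (Finset.univ : Finset (Fin 2 × ℤˣ)), (annulusSideEvent n j k.1 k.2)ᶜ) := by
    rw [← probReal_compl_eq_one_sub MeasurableSet.of_discrete, Set.compl_iInter₂]
    simp
  -- the four factors are equal to `1 - μ(top)`
  have h4 : ∏ k : Fin 2 × ℤˣ, (1 - μ.real (annulusSideEvent n j k.1 k.2)) =
      (1 - μ.real (annulusTopCrossing n j)) ^ 4 := by
    rw [Finset.prod_congr rfl fun k _ ↦ by rw [hμ, real_annulusSideEvent n j k.1 k.2],
      Finset.prod_const, Finset.card_univ, Fintype.card_prod, Fintype.card_fin,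
      Fintype.card_units_int]
  linarith

end Symmetry

/-! ### The wired top rectangle on its own vertex type -/

section TopRect

open SimpleGraph Finset

/-- The top rectangle `R_T = [-2n, 2n] × [n, 2n] ∩ ℤ²` of the annulus `S_{n,2n}`
(Duminil-Copin–Smirnov 2012, proof of Lemma 6.3, `R_T`). [cite: DuminilCopinSmirnov2012Clay, proof of Lemma 6.3] -/
def topRectSites (n : ℕ) : Finset (Site 2) :=
  Finset.Icc ![-(2 * n : ℤ), n] ![(2 * n : ℤ), 2 * n]

/-- Membership in `topRectSites n`: `-2n ≤ x₀ ≤ 2n` and `n ≤ x₁ ≤ 2n`. [folklore] -/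
theorem mem_topRectSites_iff {n : ℕ} {x : Site 2} :
    x ∈ topRectSites n ↔ -(2 * n : ℤ) ≤ x 0 ∧ x 0 ≤ 2 * n ∧ (n : ℤ) ≤ x 1 ∧ x 1 ≤ 2 * n := by
  simp only [topRectSites, Finset.mem_Icc, Pi.le_def, Fin.forall_fin_two, Matrix.cons_val_zero,
    Matrix.cons_val_one]
  tauto

/-- The top rectangle lies in the annulus. [cite: DuminilCopinSmirnov2012Clay, proof of Lemma 6.3] -/
theorem topRectSites_subset (n : ℕ) : topRectSites n ⊆ squareAnnulusSites n := by
  intro x hx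
  obtain ⟨h1, h2, h3, h4⟩ := mem_topRectSites_iff.1 hx
  rw [mem_squareAnnulusSites_iff]
  refine ⟨le_max_of_le_right ?_, max_le ?_ ?_⟩
  · rw [abs_of_nonneg (by omega)]; exact h3
  · exact abs_le.2 ⟨h1, h2⟩
  · rw [abs_of_nonneg (by omega)]; exact h4

/-- A site of the annulus at height `≥ n` lies in the top rectangle. [folklore] -/
theorem mem_topRectSites_of_mem_annulus {n : ℕ} {x : Site 2} (hx : x ∈ squareAnnulusSites n)
    (h1 : (n : ℤ) ≤ x 1) : x ∈ topRectSites n := by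
  rw [mem_squareAnnulusSites_iff, max_le_iff, abs_le, abs_le] at hx
  rw [mem_topRectSites_iff]
  omega

/-- The inner vertex boundary of the top rectangle in `ℤ²` is its ring: the four sides
`{x₁ = n}`, `{x₁ = 2n}`, `{x₀ = ±2n}`. [folklore] -/
theorem mem_innerBoundary_topRectSites_iff {n : ℕ} {x : Site 2} :
    x ∈ innerBoundary (zdGraph 2) (topRectSites n) ↔
      x ∈ topRectSites n ∧ (x 1 = n ∨ x 1 = 2 * n ∨ x 0 = -(2 * n : ℤ) ∨ x 0 = 2 * n) := by
  rw [mem_innerBoundary_iff]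
  refine and_congr_right fun hx ↦ ⟨?_, ?_⟩
  · rintro ⟨y, hy, hxy⟩
    rw [mem_topRectSites_iff] at hx hy
    rw [zdGraph_two_adj_iff] at hxy
    omega
  · intro h
    rw [mem_topRectSites_iff] at hx
    rcases h with h | h | h | h
    · refine ⟨x - Pi.single 1 1, fun hy ↦ ?_, zdGraph_adj_sub_single_one x 1⟩
      rw [mem_topRectSites_iff] at hy; simp at hy; omega
    · refine ⟨x + Pi.single 1 1, fun hy ↦ ?_, (zdGraph_adj_iff _ _).2 ⟨1, Or.inl rfl⟩⟩
      rw [mem_topRectSites_iff] at hy; simp at hy; omega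
    · refine ⟨x - Pi.single 0 1, fun hy ↦ ?_, zdGraph_adj_sub_single_one x 0⟩
      rw [mem_topRectSites_iff] at hy; simp at hy; omega
    · refine ⟨x + Pi.single 0 1, fun hy ↦ ?_, (zdGraph_adj_iff _ _).2 ⟨0, Or.inl rfl⟩⟩
      rw [mem_topRectSites_iff] at hy; simp at hy; omega

/-- **The wired top rectangle** `φ¹_{p_sd,2,R_T}`: the critical FK-Ising random-cluster measure of
the nearest-neighbour graph of `R_T = [-2n, 2n] × [n, 2n]` on its own vertex type, with its ring
`∂R_T` wired (Duminil-Copin–Smirnov 2012, proof of Lemma 6.3: Thm. 3.16 is applied to `R_T` with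
"the wired boundary conditions"; in the API of `RandomClusterDomainMarkov.lean`).
[cite: DuminilCopinSmirnov2012Clay, proof of Lemma 6.3] -/
def wiredTopRectMeasure (n : ℕ) : Measure (BondConfig ↥(topRectSites n)) :=
  rcMeasure (finsetGraph (zdGraph 2) (topRectSites n)) criticalFKIsingParam 2
    (wiredBoundary (zdGraph 2) (topRectSites n))

/-- The wired top rectangle is a probability measure. [cite: Grimmett2006, §1.2] -/
instance wiredTopRectMeasure.instIsProbabilityMeasure (n : ℕ) :
    IsProbabilityMeasure (wiredTopRectMeasure n) := by
  unfold wiredTopRectMeasure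
  exact isProbabilityMeasure_rcMeasure _ criticalFKIsingParam_mem_Icc two_pos _

/-- **The top crossing, away from the short sides, of the top rectangle on its own vertex type**:
an open path of `R_T` from its bottom side `{x₁ = n}` to the row `{x₁ = 2n - 1 - j}` inside
`[-2n+1, 2n-1] × [n, 2n-1-j]` (the event `annulusTopCrossing`, read on `R_T`).
[cite: DuminilCopinSmirnov2012Clay, proof of Lemma 6.3] -/
def topRectCrossing (n j : ℕ) : Set (BondConfig ↥(topRectSites n)) :=
  openCrossing {x | (n : ℤ) ≤ x.1 1 ∧ x.1 1 ≤ 2 * n - 1 - j ∧ supNormTwo x.1 ≤ 2 * n - 1}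
    {x | x.1 1 = n} {x | x.1 1 = 2 * n - 1 - j}

/-- The top crossing of `R_T` is an increasing event. [folklore] -/
theorem isUpperSet_topRectCrossing (n j : ℕ) : IsUpperSet (topRectCrossing n j) :=
  isUpperSet_openCrossing _ _ _

/-- Transport of open crossings along an injection, with the target sets given as the images
(`map_image_mem_openCrossing_iff`, restated for rewriting-free use). [folklore] -/
theorem map_image_mem_openCrossing_iff' {V U : Type*} (j : V ↪ U) (ω : BondConfig V)
    (S A B : Set V) (S' A' B' : Set U) (hS : S' = j '' S) (hA : A' = j '' A)
    (hB : B' = j '' B) :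
    Sym2.map j '' ω ∈ openCrossing S' A' B' ↔ ω ∈ openCrossing S A B := by
  subst hS hA hB
  exact map_image_mem_openCrossing_iff j ω S A B

/-- The wired set "annulus boundary together with everything at height `≤ n`": inside the top
rectangle this is exactly its ring `∂R_T`, and every annulus site outside `R_T` belongs to it.
[cite: DuminilCopinSmirnov2012Clay, proof of Lemma 6.3] -/
theorem mem_inner_union_outer_union_le_iff {n : ℕ} (hn : 1 ≤ n)
    (u : ↥(squareAnnulusSites n)) :
    u ∈ (squareAnnulusInner n ∪ squareAnnulusOuter n ∪
        {x : ↥(squareAnnulusSites n : Set (Site 2)) | x.1 1 ≤ n}) ↔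
      ∀ x : ↥(topRectSites n), finsetInclEmb (topRectSites_subset n) x = u →
        x ∈ wiredBoundary (zdGraph 2) (topRectSites n) := by
  have hu := u.2
  rw [mem_squareAnnulusSites_iff, max_le_iff, abs_le, abs_le, le_max_iff] at hu
  change (max |u.1 0| |u.1 1| = n ∨ max |u.1 0| |u.1 1| = 2 * n) ∨ u.1 1 ≤ n ↔ _
  constructor
  · rintro h x rfl
    rw [mem_wiredBoundary_iff, mem_innerBoundary_topRectSites_iff]
    refine ⟨x.2, ?_⟩
    have hx := mem_topRectSites_iff.1 x.2
    change (max |x.1 0| |x.1 1| = n ∨ max |x.1 0| |x.1 1| = 2 * n) ∨ x.1 1 ≤ n at h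
    have h0 := abs_le.1 (le_max_left |x.1 0| |x.1 1|)
    rw [abs_of_nonneg (show (0 : ℤ) ≤ x.1 1 by omega)] at h h0
    rcases h with (h | h) | h
    · left; have := le_max_right |x.1 0| (x.1 1); omega
    · rw [max_eq_iff, abs_eq (by positivity)] at h; omega
    · omega
  · intro h
    by_cases hR : u.1 ∈ topRectSites n
    · have := h ⟨u.1, hR⟩ (Subtype.ext rfl)
      rw [mem_wiredBoundary_iff, mem_innerBoundary_topRectSites_iff] at this
      obtain ⟨-, h'⟩ := this
      have hx := mem_topRectSites_iff.1 hR
      rw [abs_of_nonneg (show (0 : ℤ) ≤ u.1 1 by omega)]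
      rcases h' with h' | h' | h' | h'
      · exact Or.inr h'.le
      · left; right; rw [h']; exact max_eq_right (abs_le.2 ⟨by omega, by omega⟩)
      · left; right; rw [h', abs_neg, abs_of_nonneg (by positivity)]; exact max_eq_left (by omega)
      · left; right; rw [h', abs_of_nonneg (by positivity)]; exact max_eq_left (by omega)
    · right
      by_contra hlt
      exact hR (mem_topRectSites_of_mem_annulus u.2 (by omega))

/-- The value-defined vertex sets of the annulus at height `≥ n` are the images of the corresponding
vertex sets of the top rectangle under the inclusion. [folklore] -/
theorem setOf_annulus_eq_image_topRect {n : ℕ} (P : Site 2 → Prop) (hP : ∀ v, P v → (n : ℤ) ≤ v 1) :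
    ({u : ↥(squareAnnulusSites n : Set (Site 2)) | P u.1} : Set _) =
      finsetInclEmb (topRectSites_subset n) '' {x : ↥(topRectSites n) | P x.1} := by
  ext u
  constructor
  · intro hu
    exact ⟨⟨u.1, mem_topRectSites_of_mem_annulus u.2 (hP _ hu)⟩, hu, Subtype.ext rfl⟩
  · rintro ⟨x, hx, rfl⟩
    exact hx

/-- The top crossing of the annulus corresponds, along the inclusion `R_T ⊆ S_{n,2n}`, to the top
crossing of `R_T`. [folklore] -/
theorem coe_map_mem_annulusTopCrossing_iff {n j : ℕ} (hj : j + 1 ≤ n)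
    (ω : Finset (Sym2 ↥(topRectSites n))) :
    (↑(ω.map (finsetInclEmb (topRectSites_subset n)).sym2Map) :
        BondConfig ↥(squareAnnulusSites n : Set (Site 2))) ∈ annulusTopCrossing n j ↔
      (↑ω : BondConfig ↥(topRectSites n)) ∈ topRectCrossing n j := by
  rw [coe_map_sym2Map]
  exact map_image_mem_openCrossing_iff' (finsetInclEmb (topRectSites_subset n)) (↑ω) _ _ _ _ _ _
    (setOf_annulus_eq_image_topRect
      (fun v ↦ (n : ℤ) ≤ v 1 ∧ v 1 ≤ 2 * n - 1 - j ∧ supNormTwo v ≤ 2 * n - 1) fun v hv ↦ hv.1)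
    (setOf_annulus_eq_image_topRect (fun v ↦ v 1 = n) fun v hv ↦ hv.ge)
    (setOf_annulus_eq_image_topRect (fun v ↦ v 1 = 2 * n - 1 - j) fun v hv ↦ by rw [hv]; omega)

/-- The ring of the top rectangle is nonempty (it contains `(0, n)`). [folklore] -/
theorem wiredBoundary_topRectSites_nonempty (n : ℕ) :
    (wiredBoundary (zdGraph 2) (topRectSites n)).Nonempty := by
  have h0 : (![0, (n : ℤ)] : Site 2) ∈ topRectSites n := by
    rw [mem_topRectSites_iff]; simp only [Matrix.cons_val_zero, Matrix.cons_val_one]; omega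
  refine ⟨⟨![0, (n : ℤ)], h0⟩, ?_⟩
  change (![0, (n : ℤ)] : Site 2) ∈ innerBoundary (zdGraph 2) (topRectSites n)
  rw [mem_innerBoundary_topRectSites_iff]
  exact ⟨h0, Or.inl (by simp)⟩

/-- **The wired rectangle seen on the annulus is the wired rectangle** (the identification step of
the domain Markov property, `rcMeasure_real_map_of_wired`): the random-cluster measure of the
spanning graph of the annulus sites whose edges are those of `R_T`, wired on "annulus boundary and
everything at height `≤ n`" (which is `∂R_T` inside `R_T` and contains every idle site), gives the
top crossing the probability the wired top rectangle on its own vertex type gives it.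
[cite: Grimmett2006, Lemma (4.13)] -/
theorem real_fromEdgeSet_annulusTopCrossing_eq {n j : ℕ} (hn : 1 ≤ n) (hj : j + 1 ≤ n) :
    (rcMeasure (fromEdgeSet (↑(insideEdges (zdGraph 2) (topRectSites_subset n)) :
        Set (Sym2 ↥(squareAnnulusSites n)))) criticalFKIsingParam 2
        ((squareAnnulusInner n ∪ squareAnnulusOuter n ∪
          {x : ↥(squareAnnulusSites n : Set (Site 2)) | x.1 1 ≤ n} :
            Set ↥(squareAnnulusSites n : Set (Site 2))) : Set ↥(squareAnnulusSites n))).real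
        (annulusTopCrossing n j : Set (BondConfig ↥(squareAnnulusSites n))) =
      (wiredTopRectMeasure n).real (topRectCrossing n j) := by
  have hFE := insideEdges_subset_edgeFinset (G := zdGraph 2) (topRectSites_subset n)
  -- the edge set of the spanning graph, with the generic `Fintype` instance of `rcMeasure`
  have hE : @edgeFinset _ (fromEdgeSet (↑(insideEdges (zdGraph 2) (topRectSites_subset n)) :
      Set (Sym2 ↥(squareAnnulusSites n))))
      (fromEdgeSet (↑(insideEdges (zdGraph 2) (topRectSites_subset n)) :
        Set (Sym2 ↥(squareAnnulusSites n)))).fintypeEdgeSet =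
      (finsetGraph (zdGraph 2) (topRectSites n)).edgeFinset.map
        (finsetInclEmb (topRectSites_subset n)).sym2Map :=
    @edgeFinset_fromEdgeSet_of_subset _ _ (finsetGraph (zdGraph 2) (squareAnnulusSites n)) _ _ hFE
      (SimpleGraph.fintypeEdgeSet _)
  unfold wiredTopRectMeasure
  exact rcMeasure_real_map_of_wired (G := finsetGraph (zdGraph 2) (topRectSites n))
    (G' := fromEdgeSet (↑(insideEdges (zdGraph 2) (topRectSites_subset n)) :
      Set (Sym2 ↥(squareAnnulusSites n))))
    (finsetInclEmb (topRectSites_subset n)) hE criticalFKIsingParam_mem_Icc two_pos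
    (wiredBoundary_topRectSites_nonempty n)
    (W' := ((squareAnnulusInner n ∪ squareAnnulusOuter n ∪
      {x : ↥(squareAnnulusSites n : Set (Site 2)) | x.1 1 ≤ n} :
        Set ↥(squareAnnulusSites n : Set (Site 2))) : Set ↥(squareAnnulusSites n)))
    (mem_inner_union_outer_union_le_iff hn) fun ω _ ↦ (coe_map_mem_annulusTopCrossing_iff hj ω).symm

/-- **The annulus measure of the top crossing is at most its wired-top-rectangle probability**
(Duminil-Copin–Smirnov 2012, proof of Lemma 6.3 with Thm. 3.1 and §3.2: comparison between
boundary conditions, then the domain Markov property): wire, in addition to the annulus boundary,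
every site at height `≤ n` (`rcMeasure_real_mono_wired_of_isUpperSet`); then the edges off `R_T`
join wired sites and integrate out (`rcMeasure_real_eq_fromEdgeSet_of_outside_wired`); what is
left is the wired rectangle `R_T`, seen on the annulus vertex type with idle wired vertices, which
is the wired rectangle on its own vertex type (`real_fromEdgeSet_annulusTopCrossing_eq`).
[cite: DuminilCopinSmirnov2012Clay, proof of Lemma 6.3] -/
theorem real_annulusTopCrossing_le_wiredTopRect {n j : ℕ} (hn : 1 ≤ n) (hj : j + 1 ≤ n) :
    (fkIsingFiniteMeasure (squareAnnulusSites n) (squareAnnulusInner n ∪ squareAnnulusOuter n)).real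
        (annulusTopCrossing n j) ≤
      (wiredTopRectMeasure n).real (topRectCrossing n j) := by
  have hp := criticalFKIsingParam_mem_Icc
  have hRT := topRectSites_subset n
  have hFE : insideEdges (zdGraph 2) hRT ⊆ (finsetGraph (zdGraph 2) (squareAnnulusSites n)).edgeFinset :=
    insideEdges_subset_edgeFinset hRT
  -- step 1: comparison between boundary conditions
  have step1 : (fkIsingFiniteMeasure (squareAnnulusSites n)
      (squareAnnulusInner n ∪ squareAnnulusOuter n)).real (annulusTopCrossing n j) ≤
      (rcMeasure (finsetGraph (zdGraph 2) (squareAnnulusSites n)) criticalFKIsingParam 2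
        (squareAnnulusInner n ∪ squareAnnulusOuter n ∪
          {x : ↥(squareAnnulusSites n : Set (Site 2)) | x.1 1 ≤ n})).real (annulusTopCrossing n j) := by
    rw [fkIsingFiniteMeasure_eq_finsetGraph]
    exact rcMeasure_real_mono_wired_of_isUpperSet _ hp one_le_two Set.subset_union_left
      (isUpperSet_annulusTopCrossing n j)
  -- step 2: the edges off `R_T` join wired sites and integrate out
  have hB : ∀ e ∈ (finsetGraph (zdGraph 2) (squareAnnulusSites n)).edgeFinset,
      e ∉ insideEdges (zdGraph 2) hRT → ∀ x ∈ e,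
        x ∈ (squareAnnulusInner n ∪ squareAnnulusOuter n ∪
          {x : ↥(squareAnnulusSites n : Set (Site 2)) | x.1 1 ≤ n}) := by
    intro e he heF
    have hout : e ∈ outsideEdges (zdGraph 2) hRT := Finset.mem_sdiff.2 ⟨he, heF⟩
    have key : ∀ v : ↥(squareAnnulusSites n), v ∈ envSet (zdGraph 2) (topRectSites n)
        (squareAnnulusSites n) → v ∈ (squareAnnulusInner n ∪ squareAnnulusOuter n ∪
          {x : ↥(squareAnnulusSites n : Set (Site 2)) | x.1 1 ≤ n}) := by
      intro v hv
      rw [mem_inner_union_outer_union_le_iff hn]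
      rintro x rfl
      rcases hv with hv | hv
      · exact absurd x.2 hv
      · exact hv
    induction e using Sym2.ind with
    | h u v =>
      obtain ⟨hu, hv⟩ := mem_envSet_of_mem_outsideEdges hRT hout
      intro x hx
      rcases Sym2.mem_iff.1 hx with rfl | rfl
      · exact key _ hu
      · exact key _ hv
  have hA : ∀ ω : Finset (Sym2 ↥(squareAnnulusSites n)),
      ω ⊆ (finsetGraph (zdGraph 2) (squareAnnulusSites n)).edgeFinset →
      ((↑ω : BondConfig ↥(squareAnnulusSites n)) ∈ annulusTopCrossing n j ↔
        (↑(ω ∩ insideEdges (zdGraph 2) hRT) : BondConfig ↥(squareAnnulusSites n)) ∈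
          annulusTopCrossing n j) := by
    intro ω hω
    rw [Finset.coe_inter]
    refine mem_openCrossing_iff_inter fun e he hS ↦ ?_
    rw [Finset.mem_coe]
    have he' : e ∈ (finsetGraph (zdGraph 2) (squareAnnulusSites n)).edgeFinset :=
      hω (Finset.mem_coe.1 he)
    revert he' hS
    induction e using Sym2.ind with
    | h u v =>
      intro hS he'
      have hu : u.1 ∈ topRectSites n :=
        mem_topRectSites_of_mem_annulus u.2 (hS u (Sym2.mem_mk_left _ _)).1
      have hv : v.1 ∈ topRectSites n :=
        mem_topRectSites_of_mem_annulus v.2 (hS v (Sym2.mem_mk_right _ _)).1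
      have : s(u, v) = edgeLift hRT s(⟨u.1, hu⟩, ⟨v.1, hv⟩) := by rw [edgeLift_mk]; rfl
      rw [this, edgeLift_mem_insideEdges_iff, mem_edgeFinset, mem_edgeSet]
      exact mem_edgeFinset.1 he'
  have step2 := rcMeasure_real_eq_fromEdgeSet_of_outside_wired
    (finsetGraph (zdGraph 2) (squareAnnulusSites n)) hp two_pos
    (squareAnnulusInner n ∪ squareAnnulusOuter n ∪
      {x : ↥(squareAnnulusSites n : Set (Site 2)) | x.1 1 ≤ n})
    (insideEdges (zdGraph 2) hRT) hFE hB hA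
  -- step 3: the wired rectangle seen on the annulus is the wired rectangle
  exact step1.trans (le_of_eq (step2.trans (real_fromEdgeSet_annulusTopCrossing_eq hn hj)))

end TopRect

/-! ### Assembly: DCS Lemma 6.3 from a bound on the wired top rectangle -/

section Assembly

open SimpleGraph Finset

/-- The self-dual FK-Ising parameter `p_sd = √2/(1+√2)` lies strictly between `0` and `1`.
[cite: DuminilCopinSmirnov2012Clay, §3.2] -/
theorem criticalFKIsingParam_mem_Ioo : criticalFKIsingParam ∈ Set.Ioo (0 : ℝ) 1 := by
  unfold criticalFKIsingParam
  have h2 : 0 < Real.sqrt 2 := Real.sqrt_pos.2 two_pos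
  constructor
  · positivity
  · rw [div_lt_one (by positivity)]
    linarith

/-- **An event missing the empty configuration is not almost sure** (the empty configuration has
mass `(1-p)^{|E|} q^{k(∅)} / Z > 0` for `p < 1`): `φ^B_{G,p,q}(A) < 1` whenever `∅ ∉ A`.
[cite: Grimmett2006, §1.2 eq. (1.2)] -/
theorem rcMeasure_real_lt_one_of_empty_notMem {V : Type*} [Fintype V] [DecidableEq V]
    (G : SimpleGraph V) [DecidableRel G.Adj] {p q : ℝ} (hp : p ∈ Set.Icc (0 : ℝ) 1)
    (hp1 : p < 1) (hq : 0 < q) (B : Set V) {A : Set (BondConfig V)}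
    (hA : (∅ : BondConfig V) ∉ A) : (rcMeasure G p q B).real A < 1 := by
  classical
  haveI := isProbabilityMeasure_rcMeasure G hp hq B
  have hZ := rcPartitionFunction_pos G hp hq B
  -- the mass of the empty configuration
  have hempty : (rcMeasure G p q B).real {(∅ : BondConfig V)} =
      rcWeight G p q B ∅ / rcPartitionFunction G p q B := by
    rw [rcMeasure_real_apply G hp hq B]
    rw [Finset.sum_eq_single_of_mem ∅ (Finset.empty_mem_powerset _) fun ω _ hω ↦ ?_]
    · simp
    · rw [if_neg]
      rw [Set.mem_singleton_iff, Finset.coe_eq_empty]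
      exact hω
  have hpos : 0 < (rcMeasure G p q B).real {(∅ : BondConfig V)} := by
    rw [hempty]
    refine div_pos ?_ hZ
    unfold rcWeight
    have : 0 < 1 - p := sub_pos.2 hp1
    rw [Finset.card_empty, pow_zero, one_mul]
    positivity
  have hle : (rcMeasure G p q B).real A ≤ (rcMeasure G p q B).real {(∅ : BondConfig V)}ᶜ :=
    measureReal_mono (fun ω hω h ↦ hA (Set.mem_singleton_iff.1 h ▸ hω))
      (measure_ne_top _ _)
  rw [probReal_compl_eq_one_sub MeasurableSet.of_discrete] at hle
  linarith

/-- **Each annulus crossing probability is `< 1`** (for `n ≥ 1` the inner and outer boundaries are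
disjoint, so the empty configuration has no crossing, and it has positive mass). [folklore] -/
theorem real_annulusCrossing_lt_one {n : ℕ} (hn : 1 ≤ n)
    (B : Set ↥(squareAnnulusSites n : Set (Site 2))) :
    (fkIsingFiniteMeasure (squareAnnulusSites n) B).real
        (openCrossing Set.univ (squareAnnulusInner n) (squareAnnulusOuter n)) < 1 := by
  have hA : (∅ : BondConfig ↥(squareAnnulusSites n : Set (Site 2))) ∉
      openCrossing Set.univ (squareAnnulusInner n) (squareAnnulusOuter n) := by
    intro h
    rw [mem_openCrossing_iff] at h
    obtain ⟨x, hx, y, hy, hxy⟩ := h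
    obtain ⟨hxS, hyS, hr⟩ := hxy
    obtain ⟨W⟩ := hr
    cases W with
    | nil =>
      have hx' : max |x.1 0| |x.1 1| = n := hx
      have hy' : max |x.1 0| |x.1 1| = 2 * n := hy
      omega
    | cons hadj _ =>
      rw [SimpleGraph.comap_adj, Function.Embedding.coe_subtype, openGraph_adj] at hadj
      exact hadj.1
  unfold fkIsingFiniteMeasure
  exact rcMeasure_real_lt_one_of_empty_notMem _ criticalFKIsingParam_mem_Icc
    criticalFKIsingParam_mem_Ioo.2 two_pos B hA

/-- **DCS Lemma 6.3 from a bound on the wired top rectangle** (Duminil-Copin–Smirnov 2012,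
Lemma 6.3, everything but the appeal to Thm. 3.16 and duality proved): suppose that for some
`c₁ < 1`, some `n₀` and margins `j(n)` with `j(n) + 1 ≤ n`, for every `n ≥ n₀` the wired top
rectangle `R_T = [-2n, 2n] × [n, 2n]` (`wiredTopRectMeasure n`, critical FK-Ising measure with its
ring wired) gives probability at most `c₁` to an open path from its bottom side `{x₁ = n}` to the
row `{x₁ = 2n - 1 - j(n)}` inside `[-2n+1, 2n-1] × [n, 2n-1-j(n)]` (`topRectCrossing n (j n)`).
Then `fkIsing_annulusCrossing_le` holds: for `n ≥ n₀` the annulus crossing probability is at most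
`1 - (1 - c₁)⁴` (`real_annulusCrossing_le_one_sub_pow_top`,
`real_annulusTopCrossing_le_wiredTopRect`), and the finitely many `1 ≤ n < n₀` are absorbed
into the constant since each crossing probability is `< 1` (`real_annulusCrossing_lt_one`).
[cite: DuminilCopinSmirnov2012Clay, Lemma 6.3] -/
theorem fkIsing_annulusCrossing_le_of_topRect {c₁ : ℝ} (hc₁ : c₁ < 1) (n₀ : ℕ) (j : ℕ → ℕ)
    (hj : ∀ n, n₀ ≤ n → j n + 1 ≤ n)
    (h : ∀ n, n₀ ≤ n → (wiredTopRectMeasure n).real (topRectCrossing n (j n)) ≤ c₁) :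
    fkIsing_annulusCrossing_le := by
  set P : ℕ → ℝ := fun n ↦ (fkIsingFiniteMeasure (squareAnnulusSites n)
    (squareAnnulusInner n ∪ squareAnnulusOuter n)).real
      (openCrossing Set.univ (squareAnnulusInner n) (squareAnnulusOuter n)) with hP
  set c : ℝ := (Finset.Ico 1 n₀).fold max (1 - (1 - c₁) ^ 4) P with hc
  refine ⟨c, ?_, fun n hn ↦ ?_⟩
  · rw [hc, Finset.fold_max_lt]
    refine ⟨by linarith [pow_pos (sub_pos.2 hc₁) 4], fun n hn ↦ ?_⟩
    rw [Finset.mem_Ico] at hn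
    exact real_annulusCrossing_lt_one hn.1 _
  · change P n ≤ c
    rw [hc, Finset.le_fold_max]
    by_cases hn₀ : n < n₀
    · exact Or.inr ⟨n, Finset.mem_Ico.2 ⟨hn, hn₀⟩, le_rfl⟩
    · left
      replace hn₀ : n₀ ≤ n := not_lt.1 hn₀
      have hjn := hj n hn₀
      have h1 := real_annulusCrossing_le_one_sub_pow_top (n := n) (j := j n) hn hjn
      have h2 := (real_annulusTopCrossing_le_wiredTopRect (n := n) (j := j n) hn hjn).trans (h n hn₀)
      have h3 : (1 - c₁) ^ 4 ≤ (1 - (fkIsingFiniteMeasure (squareAnnulusSites n)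
          (squareAnnulusInner n ∪ squareAnnulusOuter n)).real (annulusTopCrossing n (j n))) ^ 4 :=
        pow_le_pow_left₀ (sub_pos.2 hc₁).le (by linarith) 4
      change (fkIsingFiniteMeasure (squareAnnulusSites n)
        (squareAnnulusInner n ∪ squareAnnulusOuter n)).real
          (openCrossing Set.univ (squareAnnulusInner n) (squareAnnulusOuter n)) ≤ 1 - (1 - c₁) ^ 4
      linarith

end Assembly

end Literature.Probability.LatticeModels
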